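import Summits.RiemannHypothesis.RiemannHypothesis.Theorems.HandoffDodgerLagrange
import HarnessLib

/-!
# HANDOFF — the EDGE IDENTITY behind the dodger's edge value (rh-explicit, track «HANDOFF», seat prove-2 gen9, ATTEMPT-16 Lemma A2 / ATTEMPT-18 (R-3))

HONEST FRAMING. Nothing here bears on the truth of RH; this is finite algebra over a field, the `u → ∞` companion of gen8's
Lagrange identity `HandoffDodgerLagrange.eval_div_prod_eq_one_sub_sum`. For a polynomial `P` with `P(0) = 1`, `deg P ≤ K` and distinct
non-zero nodes `ν_k`, comparing the `X^K`-coefficients in `P = Λ + Σ_k c_k·X·Λ^{(k)}` (`eq_nodePoly_add_sum`) gives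

  `P.coeff K · Π_k(−ν_k) = 1 − Σ_k P(ν_k)/Π_{m≠k}(1 − ν_k/ν_m)`      (`coeff_mul_prod_neg_eq_one_sub_sum`).

USE (ATTEMPT-16 A2, the GAIN side of THEOREM 16.2): the dodger cut-off is `F₀(x) = (1/2b)(1 + 2Σ_k a_{k+1}cos(ℓ_{k+1}x))` on `[−b, b]` with
`2(−1)^k a_{k+1} = P_T(ℓ_{k+1}²)/Π_{m≠k}(1 − ℓ_{k+1}²/ℓ_{m+1}²)`; at the edge `cos(ℓ_{k+1}b) = (−1)^{k+1}`, so `2b·F₀(b) = 1 − Σ_k P_T(ν_k)/Π_{m≠k}(1 − ν_k/ν_m)`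
(`ν_k = ℓ_{k+1}²`) `= P_T.coeff K · Π_k(−ℓ_{k+1}²) = Π_kℓ_{k+1}²/Π_ρ z_ρ^{2m(ρ)}` — the edge value `F₀(b⁻) = c_∞/(2b)` (up to the sign-free
identification `Π_ρ z_ρ^{2m} = Π_ρ‖z_ρ‖^{2m}` from the `ρ ↦ 1 − ρ̄` pairing). Also recorded: the top coefficients of `Λ` and `Λ^{(k)}`.
No `sorry`, standard axioms, no definitions.

References: this track (ATTEMPT-16 §2 Lemma A2; ATTEMPT-18 §3 (R-3)). Folklore (Lagrange interpolation).
-/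

set_option linter.dupNamespace false

open Polynomial Finset

namespace Summit.RiemannHypothesis.RiemannHypothesis.Theorems.Handoff

variable {𝕜 : Type*} [Field 𝕜] {K : ℕ}

/-- The `X¹`-coefficient of a factor `1 − cX` is `−c`. [folklore] -/
theorem coeff_linFactor_one (c : 𝕜) : (C (1 : 𝕜) - C c * X).coeff 1 = -c := by
  simp [coeff_one]

/-- The top coefficient of the node polynomial: `Λ.coeff K = Π_k (−ν_k⁻¹)`. [folklore] -/
theorem coeff_nodePoly (ν : Fin K → 𝕜) : (nodePoly ν).coeff K = ∏ k, (-(ν k)⁻¹) := by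
  unfold nodePoly
  have h := coeff_prod_of_natDegree_le (s := (univ : Finset (Fin K))) (fun k => C (1 : 𝕜) - C (ν k)⁻¹ * X) 1
    (fun k _ => natDegree_linFactor_le _)
  rw [card_univ, Fintype.card_fin, mul_one] at h
  rw [h]
  exact Finset.prod_congr rfl fun k _ => coeff_linFactor_one _

/-- The top coefficient of the erased node polynomial: `Λ^{(k)}.coeff (K−1) = Π_{m≠k} (−ν_m⁻¹)`. [folklore] -/
theorem coeff_nodePolyErase (ν : Fin K → 𝕜) (k : Fin K) :
    (nodePolyErase ν k).coeff (K - 1) = ∏ m ∈ univ.erase k, (-(ν m)⁻¹) := by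
  unfold nodePolyErase
  have h := coeff_prod_of_natDegree_le (s := univ.erase k) (fun m => C (1 : 𝕜) - C (ν m)⁻¹ * X) 1
    (fun m _ => natDegree_linFactor_le _)
  rw [Finset.card_erase_of_mem (mem_univ k), card_univ, Fintype.card_fin, mul_one] at h
  rw [h]
  exact Finset.prod_congr rfl fun m _ => coeff_linFactor_one _

/-- `Π_k(−ν_k⁻¹)·Π_k(−ν_k) = 1` for non-zero nodes. [folklore] -/
theorem prod_neg_inv_mul_prod_neg (ν : Fin K → 𝕜) (hν0 : ∀ k, ν k ≠ 0) (s : Finset (Fin K)) :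
    (∏ k ∈ s, (-(ν k)⁻¹)) * ∏ k ∈ s, (-ν k) = 1 := by
  rw [← Finset.prod_mul_distrib]
  exact Finset.prod_eq_one fun k _ => by rw [neg_mul_neg, inv_mul_cancel₀ (hν0 k)]

/-- **The edge identity (ATTEMPT-16 Lemma A2, algebraic core).** For `P(0) = 1`, `deg P ≤ K` and distinct non-zero nodes `ν_k`:
`P.coeff K · Π_k(−ν_k) = 1 − Σ_k P(ν_k)/Π_{m≠k}(1 − ν_k/ν_m)` — the `X^K`-coefficient of `eq_nodePoly_add_sum`, equivalently the value at
`u → ∞` of `eval_div_prod_eq_one_sub_sum`. [this track, ATTEMPT-16 Lemma A2; folklore] -/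
theorem coeff_mul_prod_neg_eq_one_sub_sum (ν : Fin K → 𝕜) (hν : Function.Injective ν) (hν0 : ∀ k, ν k ≠ 0)
    (P : 𝕜[X]) (hP0 : P.eval 0 = 1) (hdeg : P.natDegree ≤ K) :
    P.coeff K * ∏ k, (-ν k) = 1 - ∑ k, P.eval (ν k) / ∏ m ∈ univ.erase k, (1 - ν k / ν m) := by
  classical
  obtain _ | K := K
  · simp [coeff_zero_eq_eval_zero, hP0]
  have hid := eq_nodePoly_add_sum ν hν hν0 P hP0 hdeg
  have hc := congrArg (fun p : 𝕜[X] => p.coeff (K + 1)) hid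
  simp only [coeff_add, finsetSum_coeff] at hc
  rw [coeff_nodePoly] at hc
  -- the summands' top coefficients
  have hterm : ∀ k : Fin (K + 1),
      (C (P.eval (ν k) / (ν k * (nodePolyErase ν k).eval (ν k))) * X * nodePolyErase ν k).coeff (K + 1) =
        P.eval (ν k) / (ν k * (nodePolyErase ν k).eval (ν k)) * ∏ m ∈ univ.erase k, (-(ν m)⁻¹) := by
    intro k
    have e := coeff_nodePolyErase ν k
    rw [Nat.add_sub_cancel] at e
    rw [mul_assoc, coeff_C_mul, coeff_X_mul, e]
  -- `Λ^{(k)}(ν_k) ≠ 0`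
  have hLk : ∀ k : Fin (K + 1), ∏ m ∈ univ.erase k, (1 - ν k / ν m) ≠ 0 := by
    intro k
    rw [Finset.prod_ne_zero_iff]
    intro m hm
    have hmk : m ≠ k := ne_of_mem_erase hm
    have : ν k / ν m ≠ 1 := by
      intro h
      rw [div_eq_one_iff_eq (hν0 m)] at h
      exact hmk (hν h).symm
    exact sub_ne_zero.2 (Ne.symm this)
  rw [hc, add_mul, Finset.sum_mul, prod_neg_inv_mul_prod_neg ν hν0, sub_eq_add_neg, ← Finset.sum_neg_distrib]
  congr 1
  refine Finset.sum_congr rfl fun k _ => ?_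
  -- `Π_{m≠k}(−ν_m⁻¹)·Π_m(−ν_m) = −ν_k`
  have h2 : (∏ m ∈ univ.erase k, (-(ν m)⁻¹)) * ∏ m, (-ν m) = -ν k := by
    rw [← Finset.mul_prod_erase _ _ (mem_univ k), mul_left_comm, prod_neg_inv_mul_prod_neg ν hν0, mul_one]
  rw [hterm k, mul_assoc, h2, eval_nodePolyErase, mul_comm, neg_mul, ← mul_div_assoc, mul_div_mul_left _ _ (hν0 k)]

end Summit.RiemannHypothesis.RiemannHypothesis.Theorems.Handoff
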